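import Summits.QuantumFields.QCD.Theses.MultibosonBridge
import Mathlib.Algebra.Group.ForwardDiff
import Mathlib.Tactic.ComputeDegree

/-!
# Refutation of `MultibosonBridge.MultibosonLatticeGap` (stmt-QuantumFields-9599)

The rank-2 crux posits, for `N_f ∈ {2, 3}`, a regularisation and, for every positive mass tuple,
multiboson data whose admissibility clause `Adm` requires per `(k, f)`: `0 < δ_k < 1`, a list `ν_{k,f}`
of non-real roots with `|t| · ∏_{z ∈ ν} |t − z|² ∈ [1 − δ_k, 1 + δ_k]` for `√ε_k · c ≤ |t| ≤ c` and
`|t| · ∏ |t − z|² ≤ 1 + δ_k` for `|t| ≤ √ε_k · c`, where `c = |m_f(k) + 4| + 4 ≥ 4`.  Whatever `ε_k > 0`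
is, the two clauses bound the MONIC real polynomial `P(t) = t · ∏ |t − z|²` (degree `m = 2|ν| + 1`)
by `1 + δ_k < 2` in absolute value on all of `[−c, c]`, an interval of length `≥ 8` — impossible:
the `m`-th finite difference of `P` with step `2c/m` over the nodes `−c, …, c` is `m! (2c/m)^m`
(Mathlib: `Polynomial.fwdDiff_iter_degree_eq_factorial`, `fwdDiff_iter_eq_sum_shift`), at least
`m! (8/m)^m ≥ (8/e)^m > 2^{m+1}` for `m ≥ 3` (`Real.pow_div_factorial_le_exp`), while the node bound
gives `≤ ∑ₖ C(m,k)(1 + δ_k) < 2^{m+1}`; the empty list fails at `t = c` (`c ≤ 1 + δ_k`).  Hence `Adm`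
is unsatisfiable for EVERY scheme and the crux is false at `N_f = 2`, `m ≡ 1`, `(k, f) = (0, 0)`
(no physics enters; the same computation shows `GapTransfer` is vacuous for `N_f ≥ 1`).  Background:
Chebyshev — a monic polynomial of degree `m` has sup norm `≥ 2 (c/2)^m` on `[−c, c]`; Lüscher's
multiboson approximation `P_n(x) = c_n ∏ₖ (x − z_k) ≈ 1/x` carries a free normalisation `c_n`
(Nucl. Phys. B 418 (1994) 637, (2.6)), which the typed clause drops.  The planner's repair is to
allow a positive constant per `(k, f)` (or rescale the spectral variable to `[−1, 1]`).
Refuter seat refuter-refute-pool-g41-16, 2026-08-15.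
-/

namespace Summit.QuantumFields.QCD.Theses.MultibosonBridge

open scoped BigOperators Topology Manifold Classical MeasureTheory ProbabilityTheory Matrix InnerProductSpace ComplexConjugate ContinuousMap
open Filter Set Function TopologicalSpace MeasureTheory

/-- **Record of the replaced/dropped route item `MultibosonLatticeGap`** = stmt-QuantumFields-9599 (ledger signature verbatim, in
the route file's namespace and `open` context; NOT a route item): after `MultibosonBridgeMultibosonLatticeGap_refuted` (below) closed the
item `refuted` at c2b31c1667f1, the route repair (`restate` under a new name, or `drop`) removed
this constant from the gate-written Theses file, while the Theorems file below — append-only,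
statement text fixed — still names it ("Unknown identifier" in the full builds of 2026-08-16).
Re-declared here under its original fully-qualified name and definiens solely so that this record
keeps elaborating. FALSE (refuted below). -/
def MultibosonLatticeGap : Prop :=
  ∀ (Nf : ℕ), Nf = 2 ∨ Nf = 3 → ∃ reg : Literature.MathematicalPhysics.QuantumFieldTheory.QCDRegularisation Nf, reg.HasMassScaling ∧ (reg.scheme 0 0 0).HasAsymptoticScaling ∧ ∀ m : Fin Nf → ℝ, (∀ f, 0 < m f) → (∀ f, ∀ᶠ k in Filter.atTop, -1 < (reg.scheme m 0 0).mq f k) ∧ ∃ (ε δ p : ℕ → ℝ) (ℓ : ℕ → ℕ) (ν : ℕ → Fin Nf → List ℂ), let sch := reg.scheme m 0 0; let Dm := fun (S : ℕ) [NeZero S] (U : Literature.MathematicalPhysics.QuantumFieldTheory.GaugeConfig 4 S (Matrix.specialUnitaryGroup (Fin 3) ℂ)) (μ : ℝ) => Literature.MathematicalPhysics.QuantumLattice.wilsonDirac (Literature.MathematicalPhysics.QuantumLattice.fundamentalRep (Fin 3)) U μ 1; let W := fun (S : ℕ) [NeZero S] (mq : Fin Nf → ℝ) (l : Fin Nf →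 List ℂ) U => (∏ f, ((l f).map fun z => ‖(Literature.MathematicalPhysics.QuantumLattice.spinorLift Literature.MathematicalPhysics.QuantumLattice.gammaFive * Dm S U (mq f) - z • 1).det‖ ^ 2).prod)⁻¹; let E := fun (S : ℕ) [NeZero S] (β : ℝ) (mq : Fin Nf → ℝ) (l : Fin Nf → List ℂ) (g : _ → ℂ) => let μW := Literature.MathematicalPhysics.QuantumFieldTheory.wilsonMeasure (d := 4) (L := S) (Literature.MathematicalPhysics.QuantumLattice.fundamentalRep (Fin 3)) β; MeasureTheory.integral μW (fun U => (W S mq l U : ℂ) * g U) / MeasureTheory.integral μW (fun U => (W S mq l U : ℂ)); let Qm := fun (S : ℕ) [NeZero S] U (μ η : ℝ) (P : Literature.Probability.LatticeModels.TorusSite 4 S × Fin 3 × Fin 4 → Prop) => ∃ v, v ≠ 0 ∧ (∀ i, ¬ P i → v i = 0) ∧ ∃ t : ℝ, t ≤ 0 ∧ ∑ i, ‖((Dm S U μ - (t : ℂ) • 1).mulVec v) i‖ ^ 2 ≤ η * ∑ i, ‖v i‖ ^ 2; let qv := fun (l : List ℂ) (t : ℝ) => (l.map fun z => ‖(t : ℂ)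 - z‖ ^ 2).prod; let Adm : Prop := (∃ ρ : ℝ, ∀ k, sch.a k * ℓ k ≤ ρ) ∧ Filter.Tendsto δ Filter.atTop (nhds 0) ∧ ∀ (k : ℕ) (f : Fin Nf), 0 < ε k ∧ 0 < δ k ∧ δ k < 1 ∧ 64 ≤ ε k * (ℓ k : ℝ) ^ 2 ∧ (∀ z ∈ ν k f, z.im ≠ 0) ∧ (∀ t : ℝ, Real.sqrt (ε k) * (|sch.mq f k + 4| + 4) ≤ |t| → |t| ≤ (|sch.mq f k + 4| + 4) → |t| * qv (ν k f) t - 1 ≤ δ k ∧ 1 - |t| * qv (ν k f) t ≤ δ k) ∧ (∀ t : ℝ, |t| ≤ Real.sqrt (ε k) * (|sch.mq f k + 4| + 4) → |t| * qv (ν k f) t ≤ 1 + δ k) ∧ ∃ (D : ℕ) (b : ℕ → ℝ), (∀ t : ℝ, |t| ≤ (|sch.mq f k + 4| + 4) → t * qv (ν k f) t = ∑ j ∈ Finset.range (D + 1), b j * (Polynomial.Chebyshev.T ℝ (j : ℤ)).eval (t / (|sch.mq f k + 4| + 4))) ∧ ∀ d : ℕ, (∑ j ∈ Finset.range (D + 1),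 if d ≤ j then |b j| else 0) ≤ (δ k)⁻¹ ^ 8 * Real.exp (-((d : ℝ) / ℓ k)); let Tail : Prop := (∀ k, 0 ≤ p k) ∧ Filter.Tendsto p Filter.atTop (nhds 0) ∧ ∀ᶠ k in Filter.atTop, ∀ S : ℕ, sch.L k ≤ S → ∀ B : Finset (Fin 4 → ℤ), (∀ x ∈ B, ∀ j, |x j| ≤ (S : ℤ)) → (∀ x ∈ B, ∀ y ∈ B, x ≠ y → ∃ j, (4 * ℓ k : ℤ) < |x j - y j| ∧ |x j - y j| + 4 * ℓ k < 2 * S + 1) → (E (2 * S + 1) (sch.β k) (fun f => sch.mq f k) (ν k) ({U | ∀ x ∈ B, ∃ f, Qm (2 * S + 1) U (sch.mq f k) (4 * ε k * (|sch.mq f k + 4| + 4) ^ 2) (fun i => ∃ y : Fin 4 → ℤ, Literature.Probability.LatticeModels.Torus.proj (2 * S + 1) y = i.1 ∧ ∀ j, |y j - x j| ≤ ℓ k)}.indicator 1)).re ≤ p k ^ B.card; let Gap := fun Δ : ℝ => ∀ (A A' : ℕ → Literature.MathematicalPhysics.QuantumLattice.LGConfig 4 (Matrix.specialUnitaryGroup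 (Fin 3) ℂ) → ℂ) (r : ℕ → ℕ), (∃ ρ : ℝ, ∀ k, sch.a k * r k ≤ ρ) → (∀ O ∈ [A, A'], ∀ k, Measurable (O k) ∧ (∀ U, ‖O k U‖ ≤ 1) ∧ ∃ es : Finset (Literature.MathematicalPhysics.QuantumLattice.ZdEdge 4), Literature.MathematicalPhysics.QuantumLattice.IsCylinder (O k) es ∧ ∀ e ∈ es, ∀ j, |e.1 j| ≤ r k) → ∃ C : ℝ, ∀ᶠ k in Filter.atTop, ∀ S : ℕ, sch.L k ≤ S → ∀ t : ℕ, t ≤ S → let plc := fun (O : ℕ → _ → ℂ) (s : ℕ) U => O k (Literature.MathematicalPhysics.QuantumLattice.configShift (-(Pi.single 0 (s : ℤ) : Fin 4 → ℤ)) (Literature.MathematicalPhysics.QuantumLattice.torusLift (2 * S + 1) U)); let Ek := E (2 * S + 1) (sch.β k) (fun f => sch.mq f k) (ν k); ‖Ek (fun U => plc A 0 U * plc A' t U) - Ek (plc A 0) * Ek (plc A' t)‖ ≤ C * Real.exp (-(Δ * (sch.a k * t))); Adm ∧ Tail ∧ ∃ Δ > 0, Gap Δ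

end Summit.QuantumFields.QCD.Theses.MultibosonBridge

namespace Summit.QuantumFields.QCD.Theorems

open Polynomial Finset

/-- The root weight `∏_{z ∈ l} |t − z|²` is non-negative. [folklore] -/
private theorem MultibosonBridgeMultibosonLatticeGap.qv_nonneg (l : List ℂ) (t : ℝ) :
    0 ≤ (l.map fun z : ℂ => ‖(t : ℂ) - z‖ ^ 2).prod := by
  apply List.prod_nonneg
  intro a ha
  rw [List.mem_map] at ha
  obtain ⟨z, -, rfl⟩ := ha
  positivity

/-- The root weight is the evaluation of the real polynomial `∏_{z ∈ l} ((X − re z)² + (im z)²)`. [folklore] -/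
private theorem MultibosonBridgeMultibosonLatticeGap.eval_fl (l : List ℂ) (t : ℝ) :
    ((l.map fun z : ℂ => (X - C z.re) ^ 2 + C (z.im ^ 2)).prod).eval t =
      (l.map fun z : ℂ => ‖(t : ℂ) - z‖ ^ 2).prod := by
  induction l with
  | nil => simp
  | cons z l ih =>
    have hz : ((X - C z.re) ^ 2 + C (z.im ^ 2) : ℝ[X]).eval t = ‖(t : ℂ) - z‖ ^ 2 := by
      rw [Complex.sq_norm, Complex.normSq_apply]
      simp
      ring
    simp only [List.map_cons, List.prod_cons, eval_mul, ih]
    rw [hz]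

/-- `∏_{z ∈ l} ((X − re z)² + (im z)²)` is monic of degree `2|l|`. [folklore] -/
private theorem MultibosonBridgeMultibosonLatticeGap.fl_monic (l : List ℂ) :
    ((l.map fun z : ℂ => (X - C z.re) ^ 2 + C (z.im ^ 2)).prod).Monic ∧
      ((l.map fun z : ℂ => (X - C z.re) ^ 2 + C (z.im ^ 2)).prod).natDegree = 2 * l.length := by
  induction l with
  | nil => simp
  | cons z l ih =>
    have hm : ((X - C z.re) ^ 2 + C (z.im ^ 2) : ℝ[X]).Monic := by
      monicity!
    have hd : ((X - C z.re) ^ 2 + C (z.im ^ 2) : ℝ[X]).natDegree = 2 := by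
      compute_degree!
    simp only [List.map_cons, List.prod_cons, List.length_cons]
    refine ⟨hm.mul ih.1, ?_⟩
    rw [hm.natDegree_mul ih.1, hd, ih.2]
    ring

/-- Numerical kernel: `2 · 2.72^m ≤ 4^m` for `m ≥ 3`. [folklore] -/
private theorem MultibosonBridgeMultibosonLatticeGap.two_mul_pow_le (m : ℕ) (hm : 3 ≤ m) :
    2 * (2.72 : ℝ) ^ m ≤ 4 ^ m := by
  induction m, hm using Nat.le_induction with
  | base => norm_num
  | succ k hk ih =>
    rw [pow_succ, pow_succ]
    nlinarith [ih, pow_pos (by norm_num : (0:ℝ) < 2.72) k]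

/-- **Monic obstruction.** No finite root list `l` makes `|t| · ∏_{z ∈ l} |t − z|²` stay below
`1 + δ < 2` on `[−c, c]` when `c ≥ 4`: `t · ∏ |t − z|²` is a monic polynomial of degree
`m = 2|l| + 1`, its `m`-th finite difference with step `2c/m` is `m! (2c/m)^m ≥ m! (8/m)^m > 2^{m+1}`
for `m ≥ 3`, while the bound at the `m + 1` nodes forces it below `2^{m+1}`; `l = []` fails at
`t = c`. [folklore] -/
private theorem MultibosonBridgeMultibosonLatticeGap.core (l : List ℂ) (c δ : ℝ) (hc : 4 ≤ c)
    (hδ : δ < 1) (h : ∀ t : ℝ, |t| ≤ c → |t| * (l.map fun z : ℂ => ‖(t : ℂ) - z‖ ^ 2).prod ≤ 1 + δ) :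
    False := by
  by_cases hl : l = []
  · subst hl
    have := h c (by rw [abs_of_nonneg (by linarith)])
    simp [abs_of_nonneg (show (0:ℝ) ≤ c by linarith)] at this
    linarith
  -- non-empty list: the monic polynomial `p = X · ∏ ((X − re z)² + (im z)²)` of degree `m = 2n+1`
  set n := l.length with hn
  have hn1 : 1 ≤ n := List.length_pos_iff.mpr hl
  set m := 2 * n + 1 with hm
  have hm3 : 3 ≤ m := by omega
  have hmpos : (0 : ℝ) < m := by positivity
  set p : ℝ[X] := X * (l.map fun z : ℂ => (X - C z.re) ^ 2 + C (z.im ^ 2)).prod with hp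
  have hF := MultibosonBridgeMultibosonLatticeGap.fl_monic l
  have hpm : p.Monic := monic_X.mul hF.1
  have hpd : p.natDegree = m := by
    rw [hp, monic_X.natDegree_mul hF.1, natDegree_X, hF.2]; ring
  have hpe : ∀ t, p.eval t = t * (l.map fun z : ℂ => ‖(t : ℂ) - z‖ ^ 2).prod := by
    intro t; rw [hp, eval_mul, eval_X, MultibosonBridgeMultibosonLatticeGap.eval_fl]
  -- step size `s = 2c/m` and the rescaled polynomial `Q(x) = p(s x − c)`
  set s : ℝ := 2 * c / m with hs
  have hspos : 0 < s := by positivity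
  set Q : ℝ[X] := p.comp (C s * X + C (-c)) with hQ
  have hlin : (C s * X + C (-c) : ℝ[X]).natDegree = 1 := natDegree_linear hspos.ne'
  have hQd : Q.natDegree = m := by
    rw [hQ, natDegree_comp, hlin, hpd, mul_one]
  have hQl : Q.leadingCoeff = s ^ m := by
    rw [hQ, leadingCoeff_comp (by rw [hlin]; exact one_ne_zero), leadingCoeff_linear hspos.ne',
      hpm.leadingCoeff, one_mul, hpd]
  have hQe : ∀ x : ℝ, Q.eval x =
      (s * x - c) * (l.map fun z : ℂ => ‖((s * x - c : ℝ) : ℂ) - z‖ ^ 2).prod := by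
    intro x
    rw [hQ, eval_comp]
    simp [hpe, sub_eq_add_neg]
  -- the finite-difference identity `Δ₁^m Q(0) = s^m · m!`
  have hfd := congrFun (Polynomial.fwdDiff_iter_degree_eq_factorial Q) 0
  rw [hQd, hQl, fwdDiff_iter_eq_sum_shift] at hfd
  simp only [Pi.smul_apply, Pi.natCast_apply, smul_eq_mul, zero_add, nsmul_eq_mul, mul_one,
    zsmul_eq_mul, Int.cast_mul, Int.cast_pow, Int.cast_neg, Int.cast_one, Int.cast_natCast] at hfd
  -- bound the alternating sum by `2^m (1 + δ)` using the hypothesis at the nodes `s k − c ∈ [−c, c]`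
  have hbound : ∀ k ∈ range (m + 1), |(-1 : ℝ) ^ (m - k) * (m.choose k : ℝ) * Q.eval (k : ℝ)|
      ≤ (m.choose k : ℝ) * (1 + δ) := by
    intro k hk
    have hkm : (k : ℝ) ≤ m := by exact_mod_cast Nat.lt_succ_iff.mp (mem_range.mp hk)
    have hk0 : (0 : ℝ) ≤ k := by positivity
    have ht : |s * k - c| ≤ c := by
      rw [abs_le]
      constructor
      · nlinarith
      · have : s * k ≤ 2 * c := by
          rw [hs, div_mul_eq_mul_div, div_le_iff₀ hmpos]; nlinarith
        linarith
    have hq := h _ ht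
    rw [abs_mul, abs_mul, abs_pow, abs_neg, abs_one, one_pow, one_mul, Nat.abs_cast, hQe, abs_mul]
    exact mul_le_mul_of_nonneg_left
      (by rwa [abs_of_nonneg (MultibosonBridgeMultibosonLatticeGap.qv_nonneg _ _)]) (by positivity)
  have hsum : |∑ k ∈ range (m + 1), (-1 : ℝ) ^ (m - k) * (m.choose k : ℝ) * Q.eval (k : ℝ)|
      ≤ 2 ^ m * (1 + δ) := by
    calc _ ≤ ∑ k ∈ range (m + 1), |(-1 : ℝ) ^ (m - k) * (m.choose k : ℝ) * Q.eval (k : ℝ)| :=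
          abs_sum_le_sum_abs _ _
      _ ≤ ∑ k ∈ range (m + 1), (m.choose k : ℝ) * (1 + δ) := sum_le_sum hbound
      _ = 2 ^ m * (1 + δ) := by
          rw [← sum_mul]; congr 1; exact_mod_cast Nat.sum_range_choose m
  rw [hfd] at hsum
  rw [abs_of_nonneg (by positivity)] at hsum
  -- arithmetic: `8^m m! ≤ (2c)^m m! = s^m m! m^m ≤ 2^m (1+δ) m^m < 2^(m+1) e^m m! < 2^(m+1) 2.72^m m! ≤ 8^m m!`
  have hfact : (m : ℝ) ^ m ≤ Real.exp 1 ^ m * m.factorial := by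
    have := Real.pow_div_factorial_le_exp (m : ℝ) (by positivity) m
    rw [div_le_iff₀ (by positivity)] at this
    rw [← Real.exp_one_pow] at this
    exact this
  have he : Real.exp 1 ^ m < (2.72 : ℝ) ^ m :=
    pow_lt_pow_left₀ (lt_trans Real.exp_one_lt_d9 (by norm_num)) (Real.exp_pos 1).le (by omega)
  have hsm : s ^ m * (m : ℝ) ^ m = (2 * c) ^ m := by
    rw [← mul_pow, hs, div_mul_cancel₀ _ hmpos.ne']
  have h8 : (8 : ℝ) ^ m ≤ (2 * c) ^ m := pow_le_pow_left₀ (by norm_num) (by linarith) m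
  have key := MultibosonBridgeMultibosonLatticeGap.two_mul_pow_le m hm3
  have hmf : (0 : ℝ) < m.factorial := by positivity
  have hA : (8 : ℝ) ^ m * m.factorial ≤ (s ^ m * m.factorial) * (m : ℝ) ^ m := by
    calc (8 : ℝ) ^ m * m.factorial ≤ (2 * c) ^ m * m.factorial :=
          mul_le_mul_of_nonneg_right h8 hmf.le
      _ = (s ^ m * m.factorial) * (m : ℝ) ^ m := by rw [← hsm]; ring
  have hB : (s ^ m * m.factorial) * (m : ℝ) ^ m ≤ 2 ^ m * (1 + δ) * (m : ℝ) ^ m :=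
    mul_le_mul_of_nonneg_right hsum (by positivity)
  have hC : 2 ^ m * (1 + δ) * (m : ℝ) ^ m < 2 ^ m * 2 * (m : ℝ) ^ m := by
    have : (0 : ℝ) < 2 ^ m * (m : ℝ) ^ m := by positivity
    nlinarith
  have hD : 2 ^ m * 2 * (m : ℝ) ^ m ≤ 2 ^ m * 2 * (Real.exp 1 ^ m * m.factorial) :=
    mul_le_mul_of_nonneg_left hfact (by positivity)
  have hE : 2 ^ m * 2 * (Real.exp 1 ^ m * m.factorial) <
      2 ^ m * 2 * ((2.72 : ℝ) ^ m * m.factorial) := by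
    apply mul_lt_mul_of_pos_left _ (by positivity)
    exact mul_lt_mul_of_pos_right he hmf
  have hF' : 2 ^ m * 2 * ((2.72 : ℝ) ^ m * m.factorial) ≤ 2 ^ m * 4 ^ m * m.factorial := by
    calc 2 ^ m * 2 * ((2.72 : ℝ) ^ m * m.factorial)
          = 2 ^ m * (2 * (2.72 : ℝ) ^ m) * m.factorial := by ring
      _ ≤ 2 ^ m * 4 ^ m * m.factorial := by gcongr
  have hG : (2 : ℝ) ^ m * 4 ^ m * m.factorial = 8 ^ m * m.factorial := by rw [← mul_pow]; norm_num
  linarith [hA, hB, hC, hD, hE, hF', hG]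

/-- Refutes `MultibosonBridge.MultibosonLatticeGap` (stmt-QuantumFields-9599): at `N_f = 2` and the
mass tuple `m ≡ 1`, any witness `reg, ε, δ, p, ℓ, ν` would satisfy the admissibility clause at
`(k, f) = (0, 0)`, whose accuracy and gap sub-clauses bound `|t| · ∏_{z ∈ ν 0 0} |t − z|²` by
`1 + δ 0 < 2` on `[−c, c]`, `c = |m_0(0) + 4| + 4 ≥ 4` — contradicting the monic obstruction
(`MultibosonBridgeMultibosonLatticeGap.core`). [folklore] -/
theorem MultibosonBridgeMultibosonLatticeGap_refuted :
    ¬ Summit.QuantumFields.QCD.Theses.MultibosonBridge.MultibosonLatticeGap := by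
  intro h
  obtain ⟨reg, -, -, hm⟩ := h 2 (Or.inl rfl)
  obtain ⟨-, ε, δ, p, ℓ, ν, hrest⟩ := hm (fun _ => 1) (fun _ => one_pos)
  obtain ⟨⟨-, -, hadm⟩, -, -⟩ := hrest
  obtain ⟨-, -, hδ1, -, -, ha, hb, -⟩ := hadm 0 0
  refine MultibosonBridgeMultibosonLatticeGap.core (ν 0 0) (|(reg.scheme (fun _ => 1) 0 0).mq 0 0 + 4| + 4)
    (δ 0) (by linarith [abs_nonneg ((reg.scheme (fun _ => 1) 0 0).mq 0 0 + 4)]) hδ1 fun t ht => ?_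
  by_cases hlt : Real.sqrt (ε 0) * (|(reg.scheme (fun _ => 1) 0 0).mq 0 0 + 4| + 4) ≤ |t|
  · have := (ha t hlt ht).1
    linarith
  · exact hb t (le_of_lt (not_le.mp hlt))

end Summit.QuantumFields.QCD.Theorems
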